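import Summits.QuantumFields.BalabanUV.T4Continuum.Support.NE3HodgeCoexactPoincareEta
import Summits.QuantumFields.BalabanUV.T4Continuum.Support.NE3SliceOrthogonality
import HarnessLib

/-!
# T⁴ programme, node NE3 — row E-MLw-(w4)-P, row H5a: THE ASSEMBLY SOCKET OF THE FLAT (P♮) ON THE CHART'S MIN-NORM SLICE —
# split (H1) + interpolant (H3) + frame bound (H4) ⟹ `Σ‖Y‖² ≤ (9 + 2·C_I + 72·d·C_F)·(L^k)²·Σ‖curl Y‖²`, N-FREE (complex core)

NE3 (node U1b), row NE3 OWNER `b2b-balaban-t4-ne3-p1` (gen 22), ruling ρ-g21-4 (journal l.16470) (W2)(W4), finding F-ne3p1-g21-1 §2;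
on H2 `NE3HodgeCoexactPoincare` (owner: the co-exact half, `(Qcoarse L)^[k] η = dPot ψ`, `Σ‖η‖² ≤ 9(L^k)²Σ‖curl Y‖²`),
(73S) `NE3SliceOrthogonality` (summation by parts), Φ1 `NE3FramePotGauge` (NE3-R2 g6: `cornerGauge`, `cdiv` periodicity).

WHAT.  The chart's slice at the flat background is the ℓ²-MIN-NORM slice `T_pt(1)` = tangent directions (`(Tcoarse L)^[k] Y = 0`)
whose flat divergence VANISHES OFF THE BLOCK CORNERS (= the orthogonal complement of the corner-trivial gauge modes `dPot Ξ₀`).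
This file proves the (P♮)-flat inequality on `T_pt(1)` as a SOCKET THEOREM taking the three crew rows as hypotheses over ONE
direction `Y = η + dPot ζ` (complex values; matrices go entrywise in the END):
* (H1) a periodic `ζ` with `η := Y − dPot ζ` flat-divergence-free everywhere (Landau∕Hodge split; NE3-R2 `NE3FlatHodgeSplit`);
* (H3) a periodic interpolant `I` of the corner datum `−ψ`, `ψ = framePot L k η − ζ∘(L^k•)` (H2), with `I((L^k)•z) = −ψ z` and
  `Σ‖dPot I‖² ≤ C_I·((L^k)^d∕(L^k)²)·Σ_z Σ_κ ‖dPot (−ψ) z κ‖²`;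
* (H4) the frame bound `Σ_{z∈periodBox N} ‖framePot L k η z‖² ≤ C_F·Σ‖η‖²` (leaf-04 `NE3FramePotBound`, ℂ twin).
MECHANISM (F-ne3p1-g21-1 §2): `‖Y‖² ≤ ‖Y + dPot ξ‖²` for every corner-trivial periodic `ξ` (min-norm, §1); the COMPETITOR
`ζ̃ := I + spikes`, spike height `framePot L k η z` at the corner `(L^k)•z` (§3), has the corner values of `ζ` (H2's corner datum), so
`ξ := ζ̃ − ζ ∈ Ξ₀` and `Y + dPot ξ = η + dPot ζ̃`; `‖η + dPot ζ̃‖² = ‖η‖² + ‖dPot ζ̃‖²` (§2, `η` co-closed);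
`‖dPot ζ̃‖² ≤ 2‖dPot I‖² + 8d·Σ_z‖framePot L k η z‖²`; then H2's two ENDs (`‖η‖² ≤ 9σ²·PC`, `Σ‖Q^kη‖² ≤ σ^{4−d}·PC`, `σ = L^k`,
`PC = Σ_x Σ_π ‖curl_π Y x‖²`) and (H3)(H4) give **`Σ‖Y‖² ≤ (9 + 2C_I + 72·d·C_F)·σ²·PC`** — no `N`, no `k` in the constant.

CONTENT ([folklore]; 0 sorry; 0 def): §1 `sum_inner_dPot_eq_zero_of_projLandau`, `sum_norm_sq_le_of_projLandau` (min-norm on T_pt);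
§2 `sum_norm_sq_add_dPot_eq_of_coclosed` (Pythagoras for a co-closed `η`); §3 the spike field `x ↦ θ(cdiv M x) − cornerGauge M θ x`:
`spike_corner`, `spike_off_corner`, `spike_add_period`, `sum_norm_spike_sq_eq`, `sum_norm_dPot_spike_sq_le` (`≤ 4d·Σ_z‖θ z‖²`);
§4 **`sum_norm_sq_le_of_split_interp_frame`** — THE SOCKET.

HONEST FRAMING.  A composition over OUR typed objects at the FLAT configuration with rows H1∕H3∕H4 as HYPOTHESES (asserted for
nothing here); the matrix END on the chart's slice Set and the (ML_w)-flat corollary are row H5b; (P♮)∕(ML_w) at the curved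
background, T-E_w and NE3 are NOT proved; nothing about Bałaban's minimisers; spine PROVED 0∕9; finite T⁴ rung (B)+1 — NOT infinite
volume, NOT mass gap, NOT BetaPertH, NOT Clay.  ABSOLUTE RULE kept.  PLACEMENT: `Summits/QuantumFields/BalabanUV/`; accepted imports only.
-/

set_option autoImplicit false

open scoped BigOperators InnerProductSpace
open Finset

namespace Summit.QuantumFields.BalabanUV.T4Continuum.NE3SlicePoincareAssembly

open Literature.MathematicalPhysics.QuantumFieldTheory.Balaban1983to89
open B7Prop1Explicit
open T4AveragingDeficitWall (Plane)
open T4AveragingDeficitWallBoundary (periodBox mem_periodBox card_periodBox sum_periodBox_shift)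
open NE3TangentNoGoWords (dPot)
open SmoothRefineNeutral (Tcoarse)
open NE3TangentFlatStructure (Qcoarse framePot framePot_add_period dPot_add dPot_add_period)
open NE3FramePotGauge (cornerGauge cornerGauge_corner cornerGauge_off_corner cornerGauge_add_period)
open NE3BlockLineAverage (sum_periodBox_blocks)
open NE3SliceOrthogonality (sum_inner_dPot_eq_neg_sum_inner_flatDiv)
open NE3HodgeCoexactPoincare (dPot_sub' iterate_Qcoarse_coexact sum_norm_sq_coexact_le_planeCurl
  sum_norm_sq_iterate_Qcoarse_coexact_le_planeCurl)
open SkeletonLattice (cdiv cdiv_eq_of_repr cdiv_add_period)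

noncomputable section

variable {d : ℕ}

/-! ## §1 Min-norm on the projected Landau slice: `‖Y‖² ≤ ‖Y + dPot ξ‖²` for corner-trivial `ξ` -/

/-- **ORTHOGONALITY ON THE PROJECTED LANDAU SLICE** (flat, complex): `M, N ≥ 1`; `Y`, `ξ` `(M·N)`-periodic; if the flat divergence
of `Y` vanishes on every block OFF its corner and `ξ` vanishes AT the corners, then `Σ_x Σ_κ ⟪dPot ξ x κ, Y x κ⟫ = 0`. [folklore] -/
theorem sum_inner_dPot_eq_zero_of_projLandau {M : ℕ} (hM : 1 ≤ M) {N : ℕ} (hN : 1 ≤ N) (ξ : Site d → ℂ)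
    (Y : Site d → Fin d → ℂ)
    (hξ : ∀ (x : Site d) (τ : Fin d), ξ (x + ((M * N : ℕ) : ℤ) • e τ) = ξ x)
    (hY : ∀ (x : Site d) (τ μ : Fin d), Y (x + ((M * N : ℕ) : ℤ) • e τ) μ = Y x μ)
    (hdiv : ∀ (z v : Site d), v ∈ periodBox (d := d) M → v ≠ 0 →
      ∑ κ : Fin d, (Y ((M : ℤ) • z + v) κ - Y ((M : ℤ) • z + v - e κ) κ) = 0)
    (hξc : ∀ z : Site d, ξ ((M : ℤ) • z) = 0) :
    ∑ x ∈ periodBox (d := d) (M * N), ∑ κ : Fin d, ⟪dPot ξ x κ, Y x κ⟫_ℝ = 0 := by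
  have hMN : 1 ≤ M * N := Nat.one_le_iff_ne_zero.mpr (Nat.mul_ne_zero (by omega) (by omega))
  rw [sum_inner_dPot_eq_neg_sum_inner_flatDiv hMN ξ Y hξ hY, neg_eq_zero,
    ← sum_periodBox_blocks M N hM (fun x => ⟪ξ x, ∑ κ : Fin d, (Y x κ - Y (x - e κ) κ)⟫_ℝ)]
  refine Finset.sum_eq_zero fun z _ => Finset.sum_eq_zero fun v hv => ?_
  by_cases h0 : v = 0
  · subst h0; rw [add_zero, hξc z, inner_zero_left]
  · rw [hdiv z v hv h0, inner_zero_right]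

/-- **PYTHAGORAS ON THE PROJECTED LANDAU SLICE**: under the hypotheses of `sum_inner_dPot_eq_zero_of_projLandau`,
`Σ‖Y + dPot ξ‖² = Σ‖Y‖² + Σ‖dPot ξ‖²` over `periodBox (M·N)`. [folklore] -/
theorem sum_norm_sq_add_dPot_eq_of_projLandau {M : ℕ} (hM : 1 ≤ M) {N : ℕ} (hN : 1 ≤ N) (ξ : Site d → ℂ)
    (Y : Site d → Fin d → ℂ)
    (hξ : ∀ (x : Site d) (τ : Fin d), ξ (x + ((M * N : ℕ) : ℤ) • e τ) = ξ x)
    (hY : ∀ (x : Site d) (τ μ : Fin d), Y (x + ((M * N : ℕ) : ℤ) • e τ) μ = Y x μ)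
    (hdiv : ∀ (z v : Site d), v ∈ periodBox (d := d) M → v ≠ 0 →
      ∑ κ : Fin d, (Y ((M : ℤ) • z + v) κ - Y ((M : ℤ) • z + v - e κ) κ) = 0)
    (hξc : ∀ z : Site d, ξ ((M : ℤ) • z) = 0) :
    ∑ x ∈ periodBox (d := d) (M * N), ∑ κ : Fin d, ‖Y x κ + dPot ξ x κ‖ ^ 2
      = ∑ x ∈ periodBox (d := d) (M * N), ∑ κ : Fin d, ‖Y x κ‖ ^ 2
        + ∑ x ∈ periodBox (d := d) (M * N), ∑ κ : Fin d, ‖dPot ξ x κ‖ ^ 2 := by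
  have horth := sum_inner_dPot_eq_zero_of_projLandau hM hN ξ Y hξ hY hdiv hξc
  have hpt : ∀ (x : Site d) (κ : Fin d),
      ‖Y x κ + dPot ξ x κ‖ ^ 2 = ‖Y x κ‖ ^ 2 + 2 * ⟪dPot ξ x κ, Y x κ⟫_ℝ + ‖dPot ξ x κ‖ ^ 2 := by
    intro x κ
    rw [norm_add_sq_real, real_inner_comm]
  simp_rw [hpt, Finset.sum_add_distrib, ← Finset.mul_sum]
  rw [horth, mul_zero, add_zero]

/-- **SLICE FIELDS ARE NORM-MINIMAL IN THEIR `dPot Ξ₀`-ORBIT**: `Σ‖Y‖² ≤ Σ‖Y + dPot ξ‖²`. [folklore] -/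
theorem sum_norm_sq_le_of_projLandau {M : ℕ} (hM : 1 ≤ M) {N : ℕ} (hN : 1 ≤ N) (ξ : Site d → ℂ)
    (Y : Site d → Fin d → ℂ)
    (hξ : ∀ (x : Site d) (τ : Fin d), ξ (x + ((M * N : ℕ) : ℤ) • e τ) = ξ x)
    (hY : ∀ (x : Site d) (τ μ : Fin d), Y (x + ((M * N : ℕ) : ℤ) • e τ) μ = Y x μ)
    (hdiv : ∀ (z v : Site d), v ∈ periodBox (d := d) M → v ≠ 0 →
      ∑ κ : Fin d, (Y ((M : ℤ) • z + v) κ - Y ((M : ℤ) • z + v - e κ) κ) = 0)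
    (hξc : ∀ z : Site d, ξ ((M : ℤ) • z) = 0) :
    ∑ x ∈ periodBox (d := d) (M * N), ∑ κ : Fin d, ‖Y x κ‖ ^ 2
      ≤ ∑ x ∈ periodBox (d := d) (M * N), ∑ κ : Fin d, ‖Y x κ + dPot ξ x κ‖ ^ 2 := by
  rw [sum_norm_sq_add_dPot_eq_of_projLandau hM hN ξ Y hξ hY hdiv hξc]
  have : 0 ≤ ∑ x ∈ periodBox (d := d) (M * N), ∑ κ : Fin d, ‖dPot ξ x κ‖ ^ 2 := by positivity
  linarith

/-! ## §2 Pythagoras for a co-closed `η` against every exact field -/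

/-- **A CO-CLOSED FIELD IS ORTHOGONAL TO EVERY COBOUNDARY**: `P ≥ 1`; `η`, `ζ` `P`-periodic, `η` flat-divergence-free everywhere
⇒ `Σ‖η + dPot ζ‖² = Σ‖η‖² + Σ‖dPot ζ‖²` over `periodBox P`. [folklore] -/
theorem sum_norm_sq_add_dPot_eq_of_coclosed {P : ℕ} (hP : 1 ≤ P) (ζ : Site d → ℂ) (η : Site d → Fin d → ℂ)
    (hζ : ∀ (x : Site d) (τ : Fin d), ζ (x + (P : ℤ) • e τ) = ζ x)
    (hη : ∀ (x : Site d) (τ μ : Fin d), η (x + (P : ℤ) • e τ) μ = η x μ)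
    (hdiv : ∀ x : Site d, ∑ κ : Fin d, (η x κ - η (x - e κ) κ) = 0) :
    ∑ x ∈ periodBox (d := d) P, ∑ κ : Fin d, ‖η x κ + dPot ζ x κ‖ ^ 2
      = ∑ x ∈ periodBox (d := d) P, ∑ κ : Fin d, ‖η x κ‖ ^ 2
        + ∑ x ∈ periodBox (d := d) P, ∑ κ : Fin d, ‖dPot ζ x κ‖ ^ 2 := by
  have horth : ∑ x ∈ periodBox (d := d) P, ∑ κ : Fin d, ⟪dPot ζ x κ, η x κ⟫_ℝ = 0 := by
    rw [sum_inner_dPot_eq_neg_sum_inner_flatDiv hP ζ η hζ hη, neg_eq_zero]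
    refine Finset.sum_eq_zero fun x _ => ?_
    rw [hdiv x, inner_zero_right]
  have hpt : ∀ (x : Site d) (κ : Fin d),
      ‖η x κ + dPot ζ x κ‖ ^ 2 = ‖η x κ‖ ^ 2 + 2 * ⟪dPot ζ x κ, η x κ⟫_ℝ + ‖dPot ζ x κ‖ ^ 2 := by
    intro x κ
    rw [norm_add_sq_real, real_inner_comm]
  simp_rw [hpt, Finset.sum_add_distrib, ← Finset.mul_sum]
  rw [horth, mul_zero, add_zero]

/-! ## §3 The corner spike field `x ↦ θ(cdiv M x) − cornerGauge M θ x` -/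

section Spike

variable {𝔸 : Type*} [NormedRing 𝔸] [NormedAlgebra ℂ 𝔸]

omit [NormedAlgebra ℂ 𝔸] in
/-- At a block corner the spike field carries the block's value: `θ (cdiv M (M•z)) − cornerGauge M θ (M•z) = θ z`. [folklore] -/
theorem spike_corner {M : ℕ} (hM : 1 ≤ M) (θ : Site d → 𝔸) (z : Site d) :
    θ (cdiv M ((M : ℤ) • z)) - cornerGauge M θ ((M : ℤ) • z) = θ z := by
  have hc : cdiv M ((M : ℤ) • z) = z :=
    cdiv_eq_of_repr (q := 0) (by simp) (fun _ => le_rfl)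
      (fun _ => by simp only [Pi.zero_apply]; exact_mod_cast (by omega : 0 < M))
  rw [cornerGauge_corner hM, hc, sub_zero]

omit [NormedAlgebra ℂ 𝔸] in
/-- Off the corner of its block the spike field vanishes: `v ∈ [0,M)^d`, `v ≠ 0` ⇒ value `0` at `M•z + v`. [folklore] -/
theorem spike_off_corner (M : ℕ) (θ : Site d → 𝔸) (z : Site d) {v : Site d} (hv : v ∈ periodBox (d := d) M)
    (hv0 : v ≠ 0) : θ (cdiv M ((M : ℤ) • z + v)) - cornerGauge M θ ((M : ℤ) • z + v) = 0 := by
  have hb := mem_periodBox.mp hv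
  have hc : cdiv M ((M : ℤ) • z + v) = z := cdiv_eq_of_repr rfl (fun i => (hb i).1) (fun i => (hb i).2)
  rw [cornerGauge_off_corner M θ z hv hv0, hc, sub_self]

omit [NormedAlgebra ℂ 𝔸] in
/-- The spike field of an `N`-periodic `θ` is `(M·N)`-periodic (`M ≥ 1`). [folklore] -/
theorem spike_add_period {M : ℕ} (hM : 1 ≤ M) {N : ℕ} {θ : Site d → 𝔸}
    (hθ : ∀ (z : Site d) (τ : Fin d), θ (z + (N : ℤ) • e τ) = θ z) (x : Site d) (τ : Fin d) :
    θ (cdiv M (x + ((M * N : ℕ) : ℤ) • e τ)) - cornerGauge M θ (x + ((M * N : ℕ) : ℤ) • e τ)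
      = θ (cdiv M x) - cornerGauge M θ x := by
  have h1 : ((M * N : ℕ) : ℤ) = (M : ℤ) * (N : ℤ) := by push_cast; ring
  rw [h1, cdiv_add_period hM (N : ℤ) x τ, hθ, cornerGauge_add_period hM hθ]

/-- **THE ℓ²-MASS OF THE SPIKE FIELD** (complex values): `Σ_{x∈periodBox (M·N)} ‖spike x‖² = Σ_{z∈periodBox N} ‖θ z‖²`. [folklore] -/
theorem sum_norm_spike_sq_eq {M : ℕ} (hM : 1 ≤ M) (N : ℕ) (θ : Site d → ℂ) :
    ∑ x ∈ periodBox (d := d) (M * N), ‖θ (cdiv M x) - cornerGauge M θ x‖ ^ 2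
      = ∑ z ∈ periodBox (d := d) N, ‖θ z‖ ^ 2 := by
  rw [← sum_periodBox_blocks M N hM (fun x => ‖θ (cdiv M x) - cornerGauge M θ x‖ ^ 2)]
  refine Finset.sum_congr rfl fun z _ => ?_
  have h0mem : (0 : Site d) ∈ periodBox (d := d) M := by
    rw [mem_periodBox]; intro i; simp only [Pi.zero_apply]; exact ⟨le_rfl, by exact_mod_cast (by omega : 0 < M)⟩
  rw [← Finset.add_sum_erase _ _ h0mem, add_zero, spike_corner hM θ z]
  have hrest : ∑ v ∈ (periodBox (d := d) M).erase 0, ‖θ (cdiv M ((M : ℤ) • z + v)) - cornerGauge M θ ((M : ℤ) • z + v)‖ ^ 2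
      = 0 := by
    refine Finset.sum_eq_zero fun v hv => ?_
    rw [Finset.mem_erase] at hv
    rw [spike_off_corner M θ z hv.2 hv.1, norm_zero]
    ring
  rw [hrest, add_zero]

/-- **THE ENERGY OF THE SPIKE FIELD** (complex values): `M, N ≥ 1`, `θ` `N`-periodic ⇒
`Σ_{x∈periodBox (M·N)} Σ_κ ‖dPot spike x κ‖² ≤ 4d·Σ_{z∈periodBox N} ‖θ z‖²` (each bond difference by `2‖a‖² + 2‖b‖²`; point
capacity is O(1) — «corner spikes are cheap»). [folklore] -/
theorem sum_norm_dPot_spike_sq_le {M : ℕ} (hM : 1 ≤ M) {N : ℕ} (hN : 1 ≤ N) (θ : Site d → ℂ)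
    (hθ : ∀ (z : Site d) (τ : Fin d), θ (z + (N : ℤ) • e τ) = θ z) :
    ∑ x ∈ periodBox (d := d) (M * N), ∑ κ : Fin d, ‖dPot (fun y => θ (cdiv M y) - cornerGauge M θ y) x κ‖ ^ 2
      ≤ 4 * d * ∑ z ∈ periodBox (d := d) N, ‖θ z‖ ^ 2 := by
  have hMN : 1 ≤ M * N := Nat.one_le_iff_ne_zero.mpr (Nat.mul_ne_zero (by omega) (by omega))
  set S : Site d → ℂ := fun y => θ (cdiv M y) - cornerGauge M θ y with hSdef
  have hSper : ∀ (x : Site d) (τ : Fin d), S (x + ((M * N : ℕ) : ℤ) • e τ) = S x := fun x τ => by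
    simp only [hSdef]; exact spike_add_period hM hθ x τ
  have hmass : ∑ x ∈ periodBox (d := d) (M * N), ‖S x‖ ^ 2 = ∑ z ∈ periodBox (d := d) N, ‖θ z‖ ^ 2 := by
    simp only [hSdef]; exact sum_norm_spike_sq_eq hM N θ
  -- each bond: ‖S(x+e_κ) − S x‖² ≤ 2‖S(x+e_κ)‖² + 2‖S x‖²
  have hpt : ∀ (x : Site d) (κ : Fin d), ‖dPot S x κ‖ ^ 2 ≤ 2 * ‖S (x + e κ)‖ ^ 2 + 2 * ‖S x‖ ^ 2 := by
    intro x κ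
    simp only [dPot]
    have h := norm_sub_le (S (x + e κ)) (S x)
    have h0 : 0 ≤ ‖S (x + e κ) - S x‖ := norm_nonneg _
    nlinarith [sq_nonneg (‖S (x + e κ)‖ - ‖S x‖), norm_nonneg (S (x + e κ)), norm_nonneg (S x)]
  have hshift : ∀ κ : Fin d, ∑ x ∈ periodBox (d := d) (M * N), ‖S (x + e κ)‖ ^ 2
      = ∑ x ∈ periodBox (d := d) (M * N), ‖S x‖ ^ 2 := fun κ =>
    sum_periodBox_shift (M * N) hMN (g := fun x => ‖S x‖ ^ 2) (fun x τ => by rw [hSper]) (e κ)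
  calc ∑ x ∈ periodBox (d := d) (M * N), ∑ κ : Fin d, ‖dPot S x κ‖ ^ 2
      ≤ ∑ x ∈ periodBox (d := d) (M * N), ∑ κ : Fin d, (2 * ‖S (x + e κ)‖ ^ 2 + 2 * ‖S x‖ ^ 2) :=
        Finset.sum_le_sum fun x _ => Finset.sum_le_sum fun κ _ => hpt x κ
    _ = 2 * ∑ κ : Fin d, ∑ x ∈ periodBox (d := d) (M * N), ‖S (x + e κ)‖ ^ 2
          + 2 * (d * ∑ x ∈ periodBox (d := d) (M * N), ‖S x‖ ^ 2) := by
        rw [Finset.sum_comm]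
        simp only [Finset.sum_add_distrib, Finset.mul_sum, Finset.sum_const, Finset.card_univ, Fintype.card_fin,
          nsmul_eq_mul]
        rw [Finset.sum_comm]
        ring
    _ = 4 * d * ∑ z ∈ periodBox (d := d) N, ‖θ z‖ ^ 2 := by
        simp only [hshift, Finset.sum_const, Finset.card_univ, Fintype.card_fin, nsmul_eq_mul]
        rw [hmass]
        ring

end Spike

/-! ## §4 THE SOCKET: split + interpolant + frame bound ⟹ (P♮)-flat on the projected Landau slice, N-free -/

/-- **THE ASSEMBLY SOCKET OF (P♮)-FLAT ON THE CHART'S MIN-NORM SLICE** (complex values).  Data: `L, N ≥ 1`, `k`; a direction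
`Y = η + dPot ζ` with `η`, `ζ` `(L^k·N)`-periodic, TANGENT (`(Tcoarse L)^[k] Y = 0`) and IN THE SLICE (flat divergence of `Y` zero
off the block corners); (H1) `η` flat-divergence-free; (H3) an `(L^k·N)`-periodic `I` with `I((L^k)•z) = −ψ z`,
`ψ z = framePot L k η z − ζ((L^k)•z)`, and `Σ‖dPot I‖² ≤ C_I·((L^k)^d∕(L^k)²)·Σ_{z∈periodBox N} Σ_κ ‖dPot (−ψ) z κ‖²`; (H4)
`Σ_{z∈periodBox N} ‖framePot L k η z‖² ≤ C_F·Σ‖η‖²`.  Then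
`Σ_{x∈periodBox (L^k·N)} Σ_κ ‖Y x κ‖² ≤ (9 + 2·C_I + 72·d·C_F)·(L^k)²·Σ_x Σ_π ‖curl_π Y x‖²` — N-FREE, k-free. [folklore] -/
theorem sum_norm_sq_le_of_split_interp_frame {L : ℕ} (hL : 1 ≤ L) {N : ℕ} (hN : 1 ≤ N) (k : ℕ)
    (η : Site d → Fin d → ℂ) (ζ I : Site d → ℂ) {CI CF : ℝ} (hCI : 0 ≤ CI) (hCF : 0 ≤ CF)
    (hη : ∀ (x : Site d) (τ μ : Fin d), η (x + ((L ^ k * N : ℕ) : ℤ) • e τ) μ = η x μ)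
    (hζ : ∀ (x : Site d) (τ : Fin d), ζ (x + ((L ^ k * N : ℕ) : ℤ) • e τ) = ζ x)
    (hI : ∀ (x : Site d) (τ : Fin d), I (x + ((L ^ k * N : ℕ) : ℤ) • e τ) = I x)
    (hT : (Tcoarse L)^[k] (fun x μ => η x μ + dPot ζ x μ) = 0)
    (hslice : ∀ (z v : Site d), v ∈ periodBox (d := d) (L ^ k) → v ≠ 0 →
      ∑ κ : Fin d, ((η (((L ^ k : ℕ) : ℤ) • z + v) κ + dPot ζ (((L ^ k : ℕ) : ℤ) • z + v) κ)
        - (η (((L ^ k : ℕ) : ℤ) • z + v - e κ) κ + dPot ζ (((L ^ k : ℕ) : ℤ) • z + v - e κ) κ)) = 0)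
    (hdiv : ∀ x : Site d, ∑ κ : Fin d, (η x κ - η (x - e κ) κ) = 0)
    (hIc : ∀ z : Site d, I (((L ^ k : ℕ) : ℤ) • z) = -(framePot L k η z - ζ (((L : ℤ) ^ k) • z)))
    (hIe : ∑ x ∈ periodBox (d := d) (L ^ k * N), ∑ κ : Fin d, ‖dPot I x κ‖ ^ 2
      ≤ CI * ((((L ^ k : ℕ) : ℝ)) ^ d / (((L ^ k : ℕ) : ℝ)) ^ 2)
        * ∑ z ∈ periodBox (d := d) N, ∑ κ : Fin d, ‖dPot (fun w => -(framePot L k η w - ζ (((L : ℤ) ^ k) • w))) z κ‖ ^ 2)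
    (hF : ∑ z ∈ periodBox (d := d) N, ‖framePot L k η z‖ ^ 2
      ≤ CF * ∑ x ∈ periodBox (d := d) (L ^ k * N), ∑ κ : Fin d, ‖η x κ‖ ^ 2) :
    ∑ x ∈ periodBox (d := d) (L ^ k * N), ∑ κ : Fin d, ‖η x κ + dPot ζ x κ‖ ^ 2
      ≤ (9 + 2 * CI + 72 * d * CF) * ((L : ℝ) ^ k) ^ 2 * ∑ x ∈ periodBox (d := d) (L ^ k * N), ∑ π : Plane d,
          ‖((η (x + e π.1.1) π.1.2 + dPot ζ (x + e π.1.1) π.1.2) - (η x π.1.2 + dPot ζ x π.1.2))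
            - ((η (x + e π.1.2) π.1.1 + dPot ζ (x + e π.1.2) π.1.1) - (η x π.1.1 + dPot ζ x π.1.1))‖ ^ 2 := by
  -- abbreviations
  set M : ℕ := L ^ k with hMdef
  have hM : 1 ≤ M := Nat.one_le_pow _ _ hL
  have hMN : 1 ≤ M * N := Nat.one_le_iff_ne_zero.mpr (Nat.mul_ne_zero (by omega) (by omega))
  have hM0 : (0 : ℝ) < (M : ℝ) := by exact_mod_cast (by omega : 0 < M)
  have hMR : ((L : ℝ) ^ k) = (M : ℝ) := by rw [hMdef]; push_cast; ring
  have hMZ : ((L : ℤ) ^ k) = (M : ℤ) := by rw [hMdef]; push_cast; ring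
  set PC : ℝ := ∑ x ∈ periodBox (d := d) (M * N), ∑ π : Plane d,
      ‖((η (x + e π.1.1) π.1.2 + dPot ζ (x + e π.1.1) π.1.2) - (η x π.1.2 + dPot ζ x π.1.2))
        - ((η (x + e π.1.2) π.1.1 + dPot ζ (x + e π.1.2) π.1.1) - (η x π.1.1 + dPot ζ x π.1.1))‖ ^ 2 with hPCdef
  have hPC0 : 0 ≤ PC := by positivity
  set A : ℝ := ∑ x ∈ periodBox (d := d) (M * N), ∑ κ : Fin d, ‖η x κ‖ ^ 2 with hAdef
  have hA0 : 0 ≤ A := by positivity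
  -- the frame potential read on the coarse lattice
  set θ : Site d → ℂ := fun z => framePot L k η z with hθdef
  have hη' : ∀ (y : Site d) (τ μ : Fin d), η (y + ((L : ℤ) ^ k * N) • e τ) μ = η y μ := by
    intro y τ μ; have := hη y τ μ; push_cast at this; exact this
  have hθper : ∀ (z : Site d) (τ : Fin d), θ (z + (N : ℤ) • e τ) = θ z := fun z τ => by
    simp only [hθdef]; exact framePot_add_period L k η hη' z τ
  -- (H2) the two ENDs of the co-exact half
  have hE1 : A ≤ 9 * (M : ℝ) ^ 2 * PC := by
    have h := sum_norm_sq_coexact_le_planeCurl hL hN k η ζ hη hζ hT hdiv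
    rw [hMR] at h; exact h
  have hE2 : ∑ z ∈ periodBox (d := d) N, ∑ κ : Fin d, ‖(Qcoarse L)^[k] η z κ‖ ^ 2 ≤ ((M : ℝ) ^ d)⁻¹ * (M : ℝ) ^ 4 * PC := by
    have h := sum_norm_sq_iterate_Qcoarse_coexact_le_planeCurl hL hN k η ζ hη hζ hT hdiv
    exact h
  -- the datum's coboundary IS `−(Qcoarse L)^[k] η`
  have hdat : ∀ (z : Site d) (κ : Fin d),
      ‖dPot (fun w => -(framePot L k η w - ζ (((L : ℤ) ^ k) • w))) z κ‖ = ‖(Qcoarse L)^[k] η z κ‖ := by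
    intro z κ
    rw [iterate_Qcoarse_coexact hL k η ζ hT z κ]
    have : dPot (fun w => -(framePot L k η w - ζ (((L : ℤ) ^ k) • w))) z κ
        = -dPot (fun w => framePot L k η w - ζ (((L : ℤ) ^ k) • w)) z κ := by
      simp only [dPot]; abel
    rw [this, norm_neg]
  have hIe' : ∑ x ∈ periodBox (d := d) (M * N), ∑ κ : Fin d, ‖dPot I x κ‖ ^ 2 ≤ CI * (M : ℝ) ^ 2 * PC := by
    refine hIe.trans ?_
    simp_rw [hdat]
    calc CI * ((M : ℝ) ^ d / (M : ℝ) ^ 2) * ∑ z ∈ periodBox (d := d) N, ∑ κ : Fin d, ‖(Qcoarse L)^[k] η z κ‖ ^ 2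
        ≤ CI * ((M : ℝ) ^ d / (M : ℝ) ^ 2) * (((M : ℝ) ^ d)⁻¹ * (M : ℝ) ^ 4 * PC) :=
          mul_le_mul_of_nonneg_left hE2 (by positivity)
      _ = CI * (M : ℝ) ^ 2 * PC := by field_simp
  -- the competitor `ζ̃ = I + spike(θ)` and the orbit element `ξ = ζ̃ − ζ`
  set S : Site d → ℂ := fun y => θ (cdiv M y) - cornerGauge M θ y with hSdef
  set ξ : Site d → ℂ := fun y => I y + S y - ζ y with hξdef
  have hSper : ∀ (x : Site d) (τ : Fin d), S (x + ((M * N : ℕ) : ℤ) • e τ) = S x := fun x τ => by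
    simp only [hSdef]; exact spike_add_period hM hθper x τ
  have hξper : ∀ (x : Site d) (τ : Fin d), ξ (x + ((M * N : ℕ) : ℤ) • e τ) = ξ x := by
    intro x τ; simp only [hξdef]; rw [hI, hSper, hζ]
  have hξc : ∀ z : Site d, ξ ((M : ℤ) • z) = 0 := by
    intro z
    simp only [hξdef, hSdef]
    rw [spike_corner hM θ z, hIc z, hMZ]
    simp only [hθdef]
    ring
  have hYper : ∀ (x : Site d) (τ μ : Fin d),
      η (x + ((M * N : ℕ) : ℤ) • e τ) μ + dPot ζ (x + ((M * N : ℕ) : ℤ) • e τ) μ = η x μ + dPot ζ x μ := by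
    intro x τ μ; rw [hη, dPot_add_period hζ]
  -- (i) min-norm: ‖Y‖² ≤ ‖Y + dPot ξ‖²
  have hmin := sum_norm_sq_le_of_projLandau hM hN ξ (fun x μ => η x μ + dPot ζ x μ) hξper hYper hslice hξc
  -- (ii) Y + dPot ξ = η + dPot ζ̃
  have hcomp : ∀ (x : Site d) (κ : Fin d),
      (η x κ + dPot ζ x κ) + dPot ξ x κ = η x κ + dPot (fun y => I y + S y) x κ := by
    intro x κ; simp only [hξdef, dPot]; ring
  simp_rw [hcomp] at hmin
  -- (iii) Pythagoras for the co-closed η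
  have hISper : ∀ (x : Site d) (τ : Fin d), I (x + ((M * N : ℕ) : ℤ) • e τ) + S (x + ((M * N : ℕ) : ℤ) • e τ) = I x + S x := by
    intro x τ; rw [hI, hSper]
  have hpyth := sum_norm_sq_add_dPot_eq_of_coclosed hMN (fun y => I y + S y) η hISper hη hdiv
  -- (iv) the competitor's energy
  have hsplit : ∑ x ∈ periodBox (d := d) (M * N), ∑ κ : Fin d, ‖dPot (fun y => I y + S y) x κ‖ ^ 2
      ≤ 2 * ∑ x ∈ periodBox (d := d) (M * N), ∑ κ : Fin d, ‖dPot I x κ‖ ^ 2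
        + 2 * ∑ x ∈ periodBox (d := d) (M * N), ∑ κ : Fin d, ‖dPot S x κ‖ ^ 2 := by
    rw [Finset.mul_sum, Finset.mul_sum, ← Finset.sum_add_distrib]
    refine Finset.sum_le_sum fun x _ => ?_
    rw [Finset.mul_sum, Finset.mul_sum, ← Finset.sum_add_distrib]
    refine Finset.sum_le_sum fun κ _ => ?_
    have hadd : dPot (fun y => I y + S y) x κ = dPot I x κ + dPot S x κ := dPot_add I S x κ
    rw [hadd]
    have h := norm_add_le (dPot I x κ) (dPot S x κ)
    have h0 : 0 ≤ ‖dPot I x κ + dPot S x κ‖ := norm_nonneg _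
    nlinarith [sq_nonneg (‖dPot I x κ‖ - ‖dPot S x κ‖), norm_nonneg (dPot I x κ), norm_nonneg (dPot S x κ)]
  have hSe : ∑ x ∈ periodBox (d := d) (M * N), ∑ κ : Fin d, ‖dPot S x κ‖ ^ 2 ≤ 4 * d * (CF * A) := by
    have h := sum_norm_dPot_spike_sq_le hM hN θ hθper
    refine h.trans ?_
    exact mul_le_mul_of_nonneg_left hF (by positivity)
  -- assemble
  have hd0 : (0 : ℝ) ≤ d := Nat.cast_nonneg _
  calc ∑ x ∈ periodBox (d := d) (M * N), ∑ κ : Fin d, ‖η x κ + dPot ζ x κ‖ ^ 2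
      ≤ A + ∑ x ∈ periodBox (d := d) (M * N), ∑ κ : Fin d, ‖dPot (fun y => I y + S y) x κ‖ ^ 2 := by
        rw [hAdef, ← hpyth]; exact hmin
    _ ≤ A + (2 * (CI * (M : ℝ) ^ 2 * PC) + 2 * (4 * d * (CF * A))) := by
        have := hsplit; nlinarith [hIe', hSe]
    _ ≤ 9 * (M : ℝ) ^ 2 * PC + (2 * (CI * (M : ℝ) ^ 2 * PC) + 2 * (4 * d * (CF * (9 * (M : ℝ) ^ 2 * PC)))) := by
        nlinarith [hE1, mul_nonneg hd0 hCF]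
    _ = (9 + 2 * CI + 72 * d * CF) * (M : ℝ) ^ 2 * PC := by ring
    _ = (9 + 2 * CI + 72 * d * CF) * ((L : ℝ) ^ k) ^ 2 * PC := by rw [hMR]

end

end Summit.QuantumFields.BalabanUV.T4Continuum.NE3SlicePoincareAssembly
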